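import Summits.HodgeConjecture.HodgeConjecture.Theorems.LinearSystemTorelliLocalTubeSpanLatticeCoordinates
import Mathlib.RingTheory.Localization.Submodule

/-!
# Route LinearSystemTorelli — crux `LocalTubeSpan` (stmt-HodgeConjecture-2490): a dual vector moves by `2Λ`

Helper file (`--supports stmt-HodgeConjecture-2490`, line `Sketch` of the crux chain, cycle 10,
continuation lead c7; the lead's stub `stub_dualMove`, worker C), serving Theorem U⁺ (the level-2
congruence subgroup lies in the subgroup generated by the squares `T_a²`, with no unimodularity
hypothesis), whose induction moves DUAL vectors: vectors `y` pairing integrally with the lattice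
`Λ = ℤS` without lying in it.

Setting: an alternating form `B` on a finite-dimensional `ℚ`-space `V`, a subset `S` with `Λ := ℤS`
finitely generated and `ℚS = V`, a vector `y` with `B(y, Λ) ⊆ ℤ`, and a unit `g` of `V` satisfying
Schnell's displayed `Sp♯₂` condition: for every functional `l` integral on `Λ` there is `v ∈ Λ` with
`l(gx - x) = 2 B(v, x)` for all `x ∈ Λ`.

* `localTubeSpan_dualMove_exists_intCast_smul_mem` — clearing denominators: every vector of
  `V = ℚS` has a non-zero integer multiple in `ℤS` (`IsLocalization.mem_span_iff` for `ℚ = Frac ℤ`);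
* `localTubeSpan_dualMove_even` — for every functional `l` integral on `Λ`, `l(gy - y)` is EVEN:
  with `N • y ∈ Λ` (`N ≠ 0`) the condition at `x := N • y` reads `N · l(gy - y) = 2N · B(v, y)`, so
  `l(gy - y) = 2 B(v, y) = -2 B(y, v) ∈ 2ℤ` (`B` alternating, `B(y, v) ∈ ℤ`);
* `localTubeSpan_dualMove` — MAIN: `g y = y + 2c` for some `c ∈ Λ`
  (`localTubeSpan_exists_half_of_even`: a vector on which every integral functional is even is twice
  a lattice vector).

No named facts; no `sorry`.
-/

-- `Summit.HodgeConjecture.HodgeConjecture.Theorems` is the mandated namespace (single-conjunct summit: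
-- Sub = Summit), which `linter.dupNamespace` flags on every declaration; the lakefile turns the
-- linter off tree-wide (weak option), restated here so stand-alone elaboration is warning-free too.
set_option linter.dupNamespace false

noncomputable section

open Literature.AlgebraicGeometry.HodgeTheory

namespace Summit.HodgeConjecture.HodgeConjecture.Theorems

variable {V : Type} [AddCommGroup V] [Module ℚ V]

/-- Clearing denominators: if `S` spans the `ℚ`-space `V`, every vector has a non-zero integer
multiple in the lattice `ℤS` (`ℚ` is the fraction field of `ℤ`). [folklore] -/
theorem localTubeSpan_dualMove_exists_intCast_smul_mem (S : Set V) (hsp : Submodule.span ℚ S = ⊤)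
    (y : V) : ∃ N : ℤ, N ≠ 0 ∧ (N : ℚ) • y ∈ Submodule.span ℤ S := by
  have hy : y ∈ Submodule.span ℚ S := hsp ▸ Submodule.mem_top
  obtain ⟨y', hy', z, rfl⟩ := (IsLocalization.mem_span_iff (nonZeroDivisors ℤ)).1 hy
  refine ⟨z, nonZeroDivisors.coe_ne_zero z, ?_⟩
  have h1 : ((z : ℤ) : ℚ) * IsLocalization.mk' ℚ (1 : ℤ) z = 1 := by
    rw [← eq_intCast (algebraMap ℤ ℚ), IsLocalization.mk'_spec', map_one]
  rwa [smul_smul, h1, one_smul]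

/-- For a vector `y` pairing integrally with `Λ = ℤS` (`ℚS = V`) and a unit `g` with Schnell's
displayed condition `l(gx - x) = 2B(v, x)` on `Λ`, every functional integral on `Λ` takes an EVEN
value on `g y - y` (apply the condition to a lattice multiple `N • y` and cancel `N`; `B` alternating).
[folklore] -/
theorem localTubeSpan_dualMove_even (B : LinearMap.BilinForm ℚ V) (hB : B.IsAlt) (S : Set V)
    (hsp : Submodule.span ℚ S = ⊤) (y : V) (hyint : ∀ a ∈ Submodule.span ℤ S, ∃ z : ℤ, B y a = z)
    (g : (V →ₗ[ℚ] V)ˣ)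
    (h4 : ∀ l : V →ₗ[ℚ] ℚ, (∀ x ∈ Submodule.span ℤ S, ∃ z : ℤ, l x = z) →
      ∃ v ∈ Submodule.span ℤ S, ∀ x ∈ Submodule.span ℤ S, l ((g : V →ₗ[ℚ] V) x - x) = 2 * B v x)
    (l : V →ₗ[ℚ] ℚ) (hl : ∀ x ∈ Submodule.span ℤ S, ∃ z : ℤ, l x = z) :
    ∃ z : ℤ, l ((g : V →ₗ[ℚ] V) y - y) = 2 * z := by
  obtain ⟨N, hN, hNy⟩ := localTubeSpan_dualMove_exists_intCast_smul_mem S hsp y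
  obtain ⟨v, hv, hvx⟩ := h4 l hl
  obtain ⟨z, hz⟩ := hyint v hv
  have hN' : (N : ℚ) ≠ 0 := Int.cast_ne_zero.2 hN
  have hvy : B v y = -(z : ℚ) := by rw [← hB.neg_eq y v, hz]
  have h := hvx _ hNy
  simp only [map_sub, map_smul, smul_eq_mul] at h
  refine ⟨-z, ?_⟩
  rw [map_sub, Int.cast_neg]
  refine mul_left_cancel₀ hN' ?_
  linear_combination h + 2 * (N : ℚ) * hvy

/-- **A dual vector moves by `2Λ`.**  For `Λ = ℤS` finitely generated and spanning the `ℚ`-space `V`,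
`B` alternating, `y` pairing integrally with `Λ`, and a unit `g` satisfying Schnell's displayed `Sp♯₂`
condition (`l(gx - x) = 2B(v, x)` on `Λ` for every integral functional `l`, some `v ∈ Λ`):
`g y = y + 2c` for some `c ∈ Λ` — no hypothesis `gΛ ⊆ Λ` is needed.  (Every integral functional is
even on `g y - y`, `localTubeSpan_dualMove_even`; lattice coordinates,
`localTubeSpan_exists_half_of_even`.) [folklore] -/
theorem localTubeSpan_dualMove [FiniteDimensional ℚ V] (B : LinearMap.BilinForm ℚ V) (hB : B.IsAlt)
    (S : Set V) (hfg : (Submodule.span ℤ S).FG) (hsp : Submodule.span ℚ S = ⊤)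
    (y : V) (hyint : ∀ a ∈ Submodule.span ℤ S, ∃ z : ℤ, B y a = z)
    (g : (V →ₗ[ℚ] V)ˣ)
    (h4 : ∀ l : V →ₗ[ℚ] ℚ, (∀ x ∈ Submodule.span ℤ S, ∃ z : ℤ, l x = z) →
      ∃ v ∈ Submodule.span ℤ S, ∀ x ∈ Submodule.span ℤ S, l ((g : V →ₗ[ℚ] V) x - x) = 2 * B v x) :
    ∃ c ∈ Submodule.span ℤ S, (g : V →ₗ[ℚ] V) y = y + (2 : ℚ) • c := by
  obtain ⟨c, hc, hce⟩ := localTubeSpan_exists_half_of_even S hfg hsp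
    (localTubeSpan_dualMove_even B hB S hsp y hyint g h4)
  exact ⟨c, hc, by rw [← hce]; abel⟩

end Summit.HodgeConjecture.HodgeConjecture.Theorems

end
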